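import Summits.ValiantsHypothesis.ValiantsHypothesis.Theorems.ValuativeGCTValuativeFlipBorderSums
import Summits.ValiantsHypothesis.ValiantsHypothesis.Theorems.ValuativeGCTValuativeFlipTwistedInheritance

/-!
# The inner permanent against the padded determinant from BORDER data, and the border form of the
# inner obstruction principle (crux `ValuativeGCT.ValuativeFlip`, stmt-ValiantsHypothesis-12624;
# wall-breaker axis "representation-stability transfer `m ↔ m + 1`", k16 gen 1, seat 3; sequel to
# `…InnerDetTransfer.lean` and `…BorderSums.lean`)

`…InnerDetTransfer.lean` transfers `P_n(μ) = mult_{μ*} ℂ[Δ_n(per_n)]` into `K_{n+J}((μ♯)*)` from an AFFINE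
hypothesis `dc(per_n) ≤ s`.  Here the hypothesis is the BORDER one of GCT, `X₀₀^{j₁} per_n ∈ Δ(det_{n+j₁})`
(`\underline{dc}(per_n) ≤ n + j₁`): the untwisted derivative preimages of the translates `A · per_n` are
padded torus averages `X_top^J ι(Σ_t β_t (D_t A) · per_n)`; by k12's placement lemma
(`exists_linSubst_paddedPerFormLex_eq_paddedForm`) their first padding `X_top^{j₁} ι(…)` is a combination of
`n + 1` translates of `X₀₀^{j₁} per_n`, i.e. of CLOSURE points of `Δ(det_{n+j₁})`, and `Δ(det)` absorbs sums of
closure points at polynomial cost (`X_pow_mul_rename_sum_smul_mem_orbitClosure_det`); the second padding to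
level `n + J` is bookkeeping (`rename_segEmb_paddedForm`: final segments compose).

* `exists_derivPreimage_of_forall_torus_sum_mem` — the derivative-preimage construction of
  `…DetEffectiveMonotone.lean` with its single det-specific input isolated as a hypothesis (membership of
  the padded torus combinations).
* `per_inner_le_det_rowLift_of_border` — **`X₀₀^{j₁} per_n ∈ Δ(det_{n+j₁})` ⟹ `P_n(μ) ≤ K_{n+J}((μ♯(n+J))*)`
  for every `μ ⊢ nδ` (`≤ n²` parts) and every `J` with `n + J ≥ (n+1)·2(n+j₁+1)^9 + 1`.**
* `not_mem_orbitClosure_det_of_innerObstruction` — **border inner obstruction principle**: an inner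
  obstruction `K_{n+J}((μ♯)*) < P_n(μ)` forces `X₀₀^{j₁} per_n ∉ Δ(det_{n+j₁})`, i.e.
  `\underline{dc}(per_n) > n + j₁`, for every `j₁` with `(n+1)·2(n+j₁+1)^9 + 1 ≤ n + J`.

Sources: Mulmuley–Sohoni 2001 §4 (Prop. 4.4, Conj. 4.3); BLMW 2011 §6.4; Kadish–Landsberg 2014 §1;
Ikenmeyer–Panova 2017 Prop. 2.6(b); Bürgisser–Ikenmeyer–Panova 2019 §5.
-/

set_option linter.dupNamespace false

namespace Summit.ValiantsHypothesis.ValiantsHypothesis.Theorems.ValuativeFlip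

open scoped BigOperators
open MvPolynomial
open Literature.NumberTheory.DiophantineGeometry
open Literature.Computability.AlgebraicComplexity
open Literature.Computability.Complexity

noncomputable section

/-- **Final segments compose**: `segEmb (b ≤ c) ∘ segEmb (a ≤ b) = segEmb (a ≤ c)`. [folklore] -/
theorem segEmb_segEmb {a b c : ℕ} (hab : a ≤ b) (hbc : b ≤ c) (x : MatIdx a) :
    segEmb hbc (segEmb hab x) = segEmb (hab.trans hbc) x := by
  apply (matIdxEquiv c).symm.injective
  apply Fin.ext
  rw [matIdxEquiv_symm_segEmb, matIdxEquiv_symm_segEmb, matIdxEquiv_symm_segEmb]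
  have h1 : a * a ≤ b * b := Nat.mul_le_mul hab hab
  have h2 : b * b ≤ c * c := Nat.mul_le_mul hbc hbc
  omega

/-- **Paddings compose**: padding `X_top^{j₁} ι(F)` (level `n + j₁`) once more to level `n + J` along the
final segment gives `X_top^J ι(F)` (`paddedForm n J F`). [folklore] -/
theorem rename_segEmb_paddedForm {n : ℕ} [NeZero n] (j₁ J : ℕ) [NeZero (n + j₁)] [NeZero (n + J)]
    (h₁ : n + j₁ ≤ n + J) (F : MvPolynomial (MatIdx n) ℂ) :
    X (topMatIdx (n + J)) ^ (n + J - (n + j₁)) * rename (segEmb h₁) (paddedForm n j₁ F) = paddedForm n J F := by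
  have hcomp : (segEmb h₁ ∘ segEmb (Nat.le_add_right n j₁) : MatIdx n → MatIdx (n + J)) =
      segEmb (Nat.le_add_right n J) :=
    funext fun x => segEmb_segEmb _ _ x
  rw [paddedForm, paddedForm, map_mul, map_pow, rename_X, segEmb_topMatIdx h₁, rename_rename, hcomp,
    ← mul_assoc, ← pow_add, show n + J - (n + j₁) + j₁ = J by omega]

/-- Orbit closures are stable under all linear substitutions (`End · q ⊆ Δ(q) ⊆ Δ(f)` for `q ∈ Δ(f)`).
[Mulmuley–Sohoni 2001 §4] -/
theorem linSubst_mem_orbitClosure_of_mem {σ : Type*} [Fintype σ] [DecidableEq σ] {f q : MvPolynomial σ ℂ}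
    (hq : q ∈ orbitClosure f) (M : Matrix σ σ ℂ) : linSubst σ ℂ M q ∈ orbitClosure f :=
  orbitClosure_subset_of_mem_holds hq (endOrbit_subset_orbitClosure_holds q ⟨M, rfl⟩)

/-- **Derivative preimages from padded torus averages** (the construction of
`exists_derivPreimage_of_hasDetRepr` with its det-specific input isolated).  Let `h` be a form of degree
`m` on `Mat_m`.  If every padded torus combination `X_top^j · ι(Σ_{t ≤ m} β_t · (D_t · h))`,
`D_t = diag((t+1)^{ε_top})`, lies in `Δ(det_{m+j})`, then some `q' ∈ Δ(det_{m+j})` has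
`(∂_top^j q')|segment = h` exactly: the inverse twist `h̃ = Σ_k (k!j!/(k+j)!) h_k` of the top-degree
decomposition of `h` is such a combination (Vandermonde interpolation, `stub_interp`), and
`(∂_top^j (X_top^j ι h̃))|segment = Δ_j h̃ = h`. [Bürgisser–Ikenmeyer–Panova 2019 Lemma 5.2;
Bürgisser 2004 Lemma 5.5(3); this crux, k16] -/
theorem exists_derivPreimage_of_forall_torus_sum_mem {m : ℕ} [NeZero m] (j : ℕ) [NeZero (m + j)]
    {h : MvPolynomial (MatIdx m) ℂ} (hh : h.IsHomogeneous m)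
    (hmem : ∀ β : Fin (m + 1) → ℂ,
      paddedForm m j (∑ t : Fin (m + 1), β t •
        linSubst (MatIdx m) ℂ (Matrix.diagonal fun i => ((((t : ℕ) : ℂ)) + 1) ^
          ((Pi.single (topMatIdx m) 1 : MatIdx m → ℕ) i)) h) ∈ orbitClosure (detFormLex ℂ (m + j))) :
    ∃ q' ∈ orbitClosure (detFormLex ℂ (m + j)),
      killCompl (segEmb_strictMono (Nat.le_add_right m j)).injective
        (iterPderiv (topMatIdx (m + j)) j q') = h := by
  classical
  -- the weight singling out the top variable: `weight w d = d_top`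
  set w : MatIdx m → ℕ := Pi.single (topMatIdx m) 1 with hw
  have hwt : ∀ d : MatIdx m →₀ ℕ, Finsupp.weight w d = d (topMatIdx m) :=
    fun d => weight_piSingle_one_apply (topMatIdx m) d
  -- coefficients of `h` beyond top-degree `m` vanish
  have hvan : ∀ d : MatIdx m →₀ ℕ, m < d (topMatIdx m) → coeff d h = 0 := by
    intro d hd
    refine hh.coeff_eq_zero (ne_of_gt ?_)
    exact lt_of_lt_of_le hd (Finsupp.le_degree (topMatIdx m) d)
  -- the inverse twist constants
  set c : ℕ → ℂ := fun k => ((((k + j).descFactorial j : ℕ) : ℂ))⁻¹ with hc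
  have hcne : ∀ k, (((k + j).descFactorial j : ℕ) : ℂ) ≠ 0 := fun k =>
    Nat.cast_ne_zero.2 (descFactorial_add_pos k j).ne'
  -- the untwisted form `h̃`
  set f : MvPolynomial (MatIdx m) ℂ :=
    ∑ k ∈ Finset.range (m + 1), c k • weightedHomogeneousComponent w k h with hf
  have hcoeff : ∀ d : MatIdx m →₀ ℕ, coeff d f = c (d (topMatIdx m)) * coeff d h := by
    intro d
    rw [hf, coeff_sum]
    simp only [coeff_smul, coeff_weightedHomogeneousComponent, smul_eq_mul, mul_ite, mul_zero, hwt]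
    rw [Finset.sum_ite_eq]
    split_ifs with hk
    · rfl
    · rw [Finset.mem_range, not_lt] at hk
      rw [hvan d (by omega), mul_zero]
  -- `h̃` is a padded torus combination
  have hsupp : ∀ d ∈ h.support, Finsupp.weight w d ≤ m := by
    intro d hd
    rw [hwt]
    by_contra hlt
    exact (MvPolynomial.mem_support_iff.mp hd) (hvan d (by omega))
  choose γ hγ using fun k : ℕ =>
    Summit.ValiantsHypothesis.ValiantsHypothesis.Theorems.BorderApolarityFixedWitnessObstructionQP.stub_interp
      (MatIdx m) w m k h hsupp
  have hfD : f = ∑ t : Fin (m + 1), (∑ k ∈ Finset.range (m + 1), c k * γ k t) •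
      linSubst (MatIdx m) ℂ (Matrix.diagonal fun i => ((((t : ℕ) : ℂ)) + 1) ^ (w i)) h := by
    rw [hf]
    simp_rw [hγ, Finset.smul_sum, smul_smul, Finset.sum_smul]
    rw [Finset.sum_comm]
  have hpad : paddedForm m j f ∈ orbitClosure (detFormLex ℂ (m + j)) := by
    rw [hfD]
    exact hmem _
  refine ⟨paddedForm m j f, hpad, ?_⟩
  -- its `j`-th top derivative restricts to `Δ_j h̃ = h`
  refine MvPolynomial.ext _ _ fun d => ?_
  rw [coeff_killCompl_iterPderiv_paddedForm, hcoeff, hc]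
  simp only
  rw [← mul_assoc, mul_inv_cancel₀ (hcne _), one_mul]

/-- **The inner permanent against the padded determinant from BORDER data.**  If
`X₀₀^{j₁} per_n ∈ Δ(det_{n+j₁})` (`\underline{dc}(per_n) ≤ n + j₁`), then for every `μ ⊢ nδ` with at most
`n²` parts and every `J` with `n + J ≥ (n+1)·2(n+j₁+1)^9 + 1`:
`P_n(μ) = mult_{μ*} ℂ[Δ_n(per_n)] ≤ K_{n+J}((μ♯(n+J))*)`.  Proof: the padding lift modulo derivative preimages
(k12) with `exists_derivPreimage_of_forall_torus_sum_mem`; the padded torus combinations of `g · per_n` are,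
after the first `j₁` paddings, combinations of `n + 1` translates `M_t · X₀₀^{j₁} per_n ∈ Δ(det_{n+j₁})`
(`exists_linSubst_paddedPerFormLex_eq_paddedForm`), absorbed by `Δ(det_{n+J})`
(`X_pow_mul_rename_sum_smul_mem_orbitClosure_det`), and the remaining padding composes
(`rename_segEmb_paddedForm`). [Mulmuley–Sohoni 2001 §4; this crux, k12 + k16] -/
theorem per_inner_le_det_rowLift_of_border (n j₁ : ℕ) [NeZero n] [NeZero (n + j₁)]
    (hB : paddedPerFormLex ℂ n (n + j₁) ∈ orbitClosure (detFormLex ℂ (n + j₁)))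
    (δ : ℕ) (μ : Nat.Partition (n * δ)) (hμ : μ.parts.card ≤ n * n)
    (J : ℕ) [NeZero (n + J)] (hJ : (n + 1) * (2 * (n + j₁ + 1) ^ 9) + 1 ≤ n + J) :
    orbitMultiplicity ℂ (paddedPerFormLex ℂ n n) n (partitionWeightLex n μ) ≤
      orbitMultiplicity ℂ (detFormLex ℂ (n + J)) (n + J) (partitionWeightLex (n + J) (rowLift μ J)) := by
  classical
  have hpow : n + j₁ + 1 ≤ (n + j₁ + 1) ^ 9 := Nat.le_self_pow (by norm_num) _
  have h₁ : n + j₁ ≤ n + J := by nlinarith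
  refine orbitMultiplicity_le_rowLift_of_derivPreimage J (detFormLex_isHomogeneous ℂ (n + J))
    (fun h => Matrix.det_mvPolynomialX_ne_zero (m := Fin (n + J)) (R := ℂ)
      (rename_injective _ toLex.injective (h.trans (map_zero _).symm))) μ hμ fun g => ?_
  rw [linSubstRep_apply]
  refine exists_derivPreimage_of_forall_torus_sum_mem J
    (linSubst_isHomogeneous _ (paddedPerFormLex_isHomogeneous ℂ le_rfl)) fun β => ?_
  -- the torus translates of `g · per_n` are translates of `per_n`
  have hAt : ∀ t : Fin (n + 1),
      linSubst (MatIdx n) ℂ (Matrix.diagonal fun i => ((((t : ℕ) : ℂ)) + 1) ^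
        ((Pi.single (topMatIdx n) 1 : MatIdx n → ℕ) i))
        (linSubst (MatIdx n) ℂ (g : Matrix (MatIdx n) (MatIdx n) ℂ) (paddedPerFormLex ℂ n n)) =
      linSubst (MatIdx n) ℂ ((Matrix.diagonal fun i => ((((t : ℕ) : ℂ)) + 1) ^
        ((Pi.single (topMatIdx n) 1 : MatIdx n → ℕ) i)) * (g : Matrix (MatIdx n) (MatIdx n) ℂ))
        (paddedPerFormLex ℂ n n) := by
    intro t
    rw [linSubst_mul]
    rfl
  -- k12's placement: the first padding of each translate is a translate of `X₀₀^{j₁} per_n`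
  choose M hM using fun t : Fin (n + 1) => exists_linSubst_paddedPerFormLex_eq_paddedForm n j₁
    ((Matrix.diagonal fun i => ((((t : ℕ) : ℂ)) + 1) ^ ((Pi.single (topMatIdx n) 1 : MatIdx n → ℕ) i)) *
      (g : Matrix (MatIdx n) (MatIdx n) ℂ))
  have hcl : ∀ t : Fin (n + 1), linSubst (MatIdx (n + j₁)) ℂ (M t) (paddedPerFormLex ℂ n (n + j₁)) ∈
      orbitClosure (detFormLex ℂ (n + j₁)) := fun t => linSubst_mem_orbitClosure_of_mem hB (M t)
  have hsum := X_pow_mul_rename_sum_smul_mem_orbitClosure_det h₁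
    (fun t => linSubst (MatIdx (n + j₁)) ℂ (M t) (paddedPerFormLex ℂ n (n + j₁))) hcl β hJ
  -- identify with the padded torus combination at level `n + J`
  have heq : X (topMatIdx (n + J)) ^ (n + J - (n + j₁)) * rename (segEmb h₁)
      (∑ t, β t • linSubst (MatIdx (n + j₁)) ℂ (M t) (paddedPerFormLex ℂ n (n + j₁))) =
      paddedForm n J (∑ t : Fin (n + 1), β t •
        linSubst (MatIdx n) ℂ (Matrix.diagonal fun i => ((((t : ℕ) : ℂ)) + 1) ^
          ((Pi.single (topMatIdx n) 1 : MatIdx n → ℕ) i))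
          (linSubst (MatIdx n) ℂ (g : Matrix (MatIdx n) (MatIdx n) ℂ) (paddedPerFormLex ℂ n n))) := by
    have hlin : ∀ (k : ℕ) [NeZero (n + k)] (F : Fin (n + 1) → MvPolynomial (MatIdx n) ℂ),
        paddedForm n k (∑ t, β t • F t) = ∑ t, β t • paddedForm n k (F t) := by
      intro k _ F
      simp only [paddedForm, map_sum, map_smul, Finset.mul_sum, mul_smul_comm]
    rw [← rename_segEmb_paddedForm j₁ J h₁, hlin j₁]
    simp_rw [hAt, ← hM]
  rw [← heq]
  exact hsum

/-- **The border inner obstruction principle.**  If for some `μ ⊢ nδ` (`≤ n²` parts) and some level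
`n + J` the unpadded permanent beats the determinant on the Kadish–Landsberg ray —
`K_{n+J}((μ♯(n+J))*) < P_n(μ)` — then `X₀₀^{j₁} per_n ∉ Δ(det_{n+j₁})`, i.e. `\underline{dc}(per_n) > n + j₁`,
for every `j₁` with `(n+1)·2(n+j₁+1)^9 + 1 ≤ n + J`. [Mulmuley–Sohoni 2001 Conj. 4.3 (border complexity);
this crux, k16] -/
theorem not_mem_orbitClosure_det_of_innerObstruction (n : ℕ) [NeZero n] (δ : ℕ)
    (μ : Nat.Partition (n * δ)) (hμ : μ.parts.card ≤ n * n) (J : ℕ) [NeZero (n + J)]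
    (hobs : orbitMultiplicity ℂ (detFormLex ℂ (n + J)) (n + J) (partitionWeightLex (n + J) (rowLift μ J)) <
      orbitMultiplicity ℂ (paddedPerFormLex ℂ n n) n (partitionWeightLex n μ))
    (j₁ : ℕ) [NeZero (n + j₁)] (hj : (n + 1) * (2 * (n + j₁ + 1) ^ 9) + 1 ≤ n + J) :
    paddedPerFormLex ℂ n (n + j₁) ∉ orbitClosure (detFormLex ℂ (n + j₁)) := fun hB =>
  (lt_irrefl _) (hobs.trans_le (per_inner_le_det_rowLift_of_border n j₁ hB δ μ hμ J hj))

end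

end Summit.ValiantsHypothesis.ValiantsHypothesis.Theorems.ValuativeFlip
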